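import Summits.Ventures.YMGap.RobustBall.LocalScreeningOnBallG
import Summits.Ventures.YMGap.RobustBall.UniformMassGapSUN
import Summits.Ventures.YMGap.RobustBall.UniformMassGapDim3Gauge
import Summits.Ventures.YMGap.RobustBall.MassGapOnBallZdGRowsSU3PV2
import HarnessLib

/-!
# Venture YMGap, track ROBUST-BALL (Y2) — star-door screening cells: `ℤ³` (`SU(2)` up to `β_W = 1/2`), every `N ≥ 2`
# (eigen modulus; `SU(3)` hypothesis-free cells), and the variance form (`SU(3)` PV2, hypothesis-free up to `β_W = 17/50`)

HONEST FRAMING. WHAT THIS IS: a venture file (cell `pub-ymgap`, track Y2 ROBUST-BALL, seat rb-p1, theorems only): further ROWS of the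
star-door screening currency `LocalScreeningOnBallZdG d N β ε₀ ε₁ R m A` (`LocalScreeningOnBallG.lean`: every member of the
gauge-invariant tier-1 ball, every bounded adapted source reading only the links of a finite `S`, every DLR pair, every Lipschitz
cylinder: `|∫F dμ − ∫F dν| ≤ A e^{−m d(Λ,S)} #Λ K_F`), on the certificates ALREADY in the tree for the mass gap through the robust
star door — nothing numeric is new here, the same `(c, λ, ρ₀)` now conclude SCREENING:
* `ℤ³`, `SU(2)` (schema `su2_dim3_localScreeningOnBallZdG_star`, `A = 4√2`, GEOMETRIC rate `log(1/max(ρ₀,½))/(max R 1 + 4)`):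
  cells `β_W = 1/4` quarter radius `(57/1000, 57/2000)` rate `log 2/(max R 1 + 4)`, half radius `(57/500, 57/1000)` rate
  `log(100/57)/(max R 1 + 4)`; ONE EXPLICIT `(m, A) = ((1/200)/(max R 1 + 4), 4√2)` for all `0 ≤ β_W ≤ 1/2` on
  `MemBallZdG (17/500) (17/1000) R`; the `ℤ³` WILSON POINT up to `β_W = 1/2` at rate `(1/200)/5`.
* every `N ≥ 2`, `d = 4`, eigen modulus (schema `suN_localScreeningOnBallZdG_star_eigen`, `A = 4√N`): `SU(3)` HYPOTHESIS-FREE cells at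
  `β_W = 1/8`: quarter radius `(37/500, 37/1000)` and half radius `(37/250, 37/500)`, both at rate `log 2/(max R 1 + 4)` (received sums
  `≤ 31/100`, `≤ 47/100`), constant `4√3`.
* the VARIANCE-FORM robust star door (`localScreeningOnBallZdG_of_robustStar_variance`, `LocalScreeningOnBallG.lean`) with engine-2's
  PV2 inputs: `SU(3)` HYPOTHESIS-FREE, ONE EXPLICIT `(m, A) = ((1/250)/(max R 1 + 4), 4√3)` for ALL `0 ≤ β_W ≤ 17/50` on
  `MemBallZdG (11/500) (11/1000) R` (`su3_localScreeningStar_pv2_upTo_seventeenFiftieths`), and the `SU(3)` Wilson point up to `17/50`.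
WHAT THIS IS NOT: one-sided Dobrushin–Shlosman comparison rates in units of the door's locality radius (small at the frontier
cells, where the certified received sum is within `1/200` of `1`); strength-free constants; lattice strong coupling only, nothing
about the continuum limit or a Clay-sense mass gap.
-/

noncomputable section

open MeasureTheory Function Finset Real
open scoped NNReal
open Literature.Probability.LatticeModels
open Literature.MathematicalPhysics.QuantumLattice
open Literature.MathematicalPhysics.QuantumFieldTheory hiding ZdEdge Site
open Literature.MathematicalPhysics.QuantumFieldTheory.Balaban1983to89.StrongCouplingDobrushinWindow
  (OneLinkKRModulus)
open Summit.QuantumFields.BalabanUV.InfraRed.StrongCouplingPoincareDoorSUN (OneLinkPoincareSUN)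
open Summit.QuantumFields.BalabanUV.InfraRed.StrongCouplingVarianceDoorSUN (OneLinkVarianceBound)
open Summit.Ventures.YMGap.StarResolventDim (Delta gaugeR doorPoly gaugeR_lt_one_of_door)

namespace Summit.Ventures.YMGap.RobustBall

variable {d N : ℕ}

/-! ### `ℤ³`, `SU(2)`: the schema on the quarter modulus and cells -/

/-- **SCHEMA, `SU(2)`, `d = 3`, robust star door on `ℤ³`** (the hypotheses of `su2_dim3_uniformMassGapOnBallZdG_star`):
`e^{ε₀} ≤ E`, `√2 ≤ S`, `c ≥ E(1 + 2Sε₁)β_W/4`, `λ ≥ Sε₁`, `doorPoly 3 c < 1`, `4c + λ < 1`,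
`gaugeR 3 c + (λ + (4c+λ)^Kn·12λ)/(1 − (4c+λ)) ≤ ρ₀ < 1 ⇒ LocalScreeningOnBallZdG 3 2 (β_W/4) ε₀ ε₁ R (log(1/max(ρ₀,½))/(max R 1 + 4)) (4√2)`. -/
theorem su2_dim3_localScreeningOnBallZdG_star (Kn : ℕ) {βW ε₀ ε₁ c lam E S ρ₀ : ℝ} (hβ0 : 0 ≤ βW) (hβ : βW ≤ 2 / 3)
    (hε₁ : 0 ≤ ε₁) (hE : Real.exp ε₀ ≤ E) (hS : Real.sqrt 2 ≤ S) (hc : E * (1 + 2 * S * ε₁) * (βW / 4) ≤ c)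
    (hlam : S * ε₁ ≤ lam) (hθ1 : 4 * c + lam < 1) (hcd : doorPoly 3 c < 1)
    (hρ0 : gaugeR 3 c + (lam + (4 * c + lam) ^ Kn * (12 * lam)) / (1 - (4 * c + lam)) ≤ ρ₀) (hρ1 : ρ₀ < 1) (R : ℕ) :
    LocalScreeningOnBallZdG 3 2 (βW / 4) ε₀ ε₁ R (-Real.log (max ρ₀ (1 / 2)) / (max R 1 + 4 : ℕ)) (4 * Real.sqrt 2) := by
  have hS0 : 0 ≤ S := (Real.sqrt_nonneg _).trans hS
  have hE0 : 0 ≤ E := (Real.exp_pos _).le.trans hE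
  set θ : ℝ := 4 * c + lam with hθ
  set ρ : ℝ := gaugeR 3 c + (lam + θ ^ Kn * (12 * lam)) / (1 - θ) with hρ
  have habs : |((2 : ℕ) : ℝ) * (βW / 4)| / ((2 : ℕ) : ℝ) = βW / 4 := by
    rw [abs_of_nonneg (by positivity)]
    push_cast
    ring
  have hR : |((2 : ℕ) : ℝ) * (βW / 4)| / ((2 : ℕ) : ℝ) * (2 * (((3 : ℕ) : ℝ) - 1)) ≤ 3 * βW / 2 := by
    rw [habs]; push_cast; linarith
  have hc' : (1 : ℝ) * Real.exp ε₀ * (1 + 2 * Real.sqrt ((2 : ℕ) : ℝ) * ε₁) *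
      (|((2 : ℕ) : ℝ) * (βW / 4)| / ((2 : ℕ) : ℝ)) ≤ c := by
    refine le_trans ?_ hc
    have h1 : Real.sqrt ((2 : ℕ) : ℝ) = Real.sqrt 2 := by norm_num
    rw [h1, one_mul, habs]
    have hb : 0 ≤ βW / 4 := by positivity
    calc Real.exp ε₀ * (1 + 2 * Real.sqrt 2 * ε₁) * (βW / 4) ≤ E * (1 + 2 * Real.sqrt 2 * ε₁) * (βW / 4) := by
          gcongr
      _ ≤ E * (1 + 2 * S * ε₁) * (βW / 4) := by gcongr
  have hlam' : Real.sqrt ((2 : ℕ) : ℝ) * ε₁ ≤ lam := by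
    have h1 : Real.sqrt ((2 : ℕ) : ℝ) = Real.sqrt 2 := by norm_num
    rw [h1]; exact le_trans (mul_le_mul_of_nonneg_right hS hε₁) hlam
  have hθ' : θ = (2 * ((3 : ℕ) : ℝ) - 2) * c + lam := by rw [hθ]; push_cast; ring
  have hρ' : ρ = gaugeR 3 c + (lam + θ ^ Kn * (4 * ((3 : ℕ) : ℝ) * lam)) / (1 - θ) := by rw [hρ]; push_cast; ring
  have h4 : (4 * Real.sqrt ((2 : ℕ) : ℝ) : ℝ) = 4 * Real.sqrt 2 := by norm_num
  rw [← h4]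
  exact localScreeningOnBallZdG_of_robustStar (d := 3) (N := 2) (by norm_num) (by norm_num) zero_le_one hR
    (su2_quarterModulus hβ) hε₁ hc' hlam' hθ' hθ1 hcd hρ' hρ0 hρ1

/-- **LINEAR READING, `ℤ³`** (`1/2 ≤ ρ₀`): rate `(1 − ρ₀)/(max R 1 + 4)`, constant `4√2`. -/
theorem su2_dim3_localScreeningOnBallZdG_star_linear (Kn : ℕ) {βW ε₀ ε₁ c lam E S ρ₀ : ℝ} (hβ0 : 0 ≤ βW) (hβ : βW ≤ 2 / 3)
    (hε₁ : 0 ≤ ε₁) (hE : Real.exp ε₀ ≤ E) (hS : Real.sqrt 2 ≤ S) (hc : E * (1 + 2 * S * ε₁) * (βW / 4) ≤ c)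
    (hlam : S * ε₁ ≤ lam) (hθ1 : 4 * c + lam < 1) (hcd : doorPoly 3 c < 1)
    (hρ0 : gaugeR 3 c + (lam + (4 * c + lam) ^ Kn * (12 * lam)) / (1 - (4 * c + lam)) ≤ ρ₀) (hhalf : 1 / 2 ≤ ρ₀)
    (hρ1 : ρ₀ < 1) (R : ℕ) :
    LocalScreeningOnBallZdG 3 2 (βW / 4) ε₀ ε₁ R ((1 - ρ₀) / (max R 1 + 4 : ℕ)) (4 * Real.sqrt 2) := by
  have h := su2_dim3_localScreeningOnBallZdG_star Kn hβ0 hβ hε₁ hE hS hc hlam hθ1 hcd hρ0 hρ1 R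
  have hD : (0 : ℝ) < ((max R 1 + 4 : ℕ) : ℝ) := by positivity
  have hmax : max ρ₀ (1 / 2) = ρ₀ := max_eq_left hhalf
  have hrate : 1 - ρ₀ ≤ -Real.log (max ρ₀ (1 / 2)) := by
    rw [hmax]; have := Real.log_le_sub_one_of_pos (show (0 : ℝ) < ρ₀ by linarith); linarith
  exact h.mono le_rfl le_rfl le_rfl (div_le_div_of_nonneg_right hrate hD.le) le_rfl (by positivity)

/-- **`ℤ³` CELL `β_W = 1/4`, QUARTER RADIUS `(57/1000, 57/2000)`**: received sum `≤ 43/100 ≤ 1/2` ⇒ screening at rate `log 2/(max R 1 + 4)`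
with constant `4√2 · #Λ · K_F` for every member, every local source, every DLR pair (certificate `c = 143/2000`, `λ = 20153/500000`). -/
theorem su2_dim3_localScreeningStar_oneQuarter_quarterRadius (R : ℕ) :
    LocalScreeningOnBallZdG 3 2 (1 / 16) (57 / 1000) (57 / 2000) R (Real.log 2 / (max R 1 + 4 : ℕ)) (4 * Real.sqrt 2) := by
  have e1 : (1 / 4 : ℝ) / 4 = 1 / 16 := by norm_num
  have h := su2_dim3_localScreeningOnBallZdG_star 20 (βW := 1 / 4) (ε₀ := 57 / 1000) (ε₁ := 57 / 2000)
    (c := 143 / 2000) (lam := 20153 / 500000) (ρ₀ := 43 / 100) (by norm_num) (by norm_num) (by norm_num)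
    (exp_le_taylor4 (x := 57 / 1000) (by norm_num) (by norm_num)) sqrt_two_le (by norm_num) (by norm_num)
    (by norm_num) (by unfold doorPoly; norm_num) (by unfold gaugeR Delta; norm_num) (by norm_num) R
  rw [e1] at h
  have hlog : -Real.log (max (43 / 100 : ℝ) (1 / 2)) = Real.log 2 := by
    rw [show max (43 / 100 : ℝ) (1 / 2) = 1 / 2 by norm_num, one_div, Real.log_inv, neg_neg]
  rw [hlog] at h
  exact h

/-- **`ℤ³` CELL `β_W = 1/4`, HALF RADIUS `(57/500, 57/1000)`**: received sum `≤ 57/100` ⇒ rate `log(100/57)/(max R 1 + 4)`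
(`≈ 0.562/…`), constant `4√2 · #Λ · K_F` (certificate `c = 81341/1000000`, `λ = 80611/1000000`). -/
theorem su2_dim3_localScreeningStar_oneQuarter_halfRadius (R : ℕ) :
    LocalScreeningOnBallZdG 3 2 (1 / 16) (57 / 500) (57 / 1000) R (Real.log (100 / 57) / (max R 1 + 4 : ℕ))
      (4 * Real.sqrt 2) := by
  have e1 : (1 / 4 : ℝ) / 4 = 1 / 16 := by norm_num
  have h := su2_dim3_localScreeningOnBallZdG_star 20 (βW := 1 / 4) (ε₀ := 57 / 500) (ε₁ := 57 / 1000)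
    (c := 81341 / 1000000) (lam := 80611 / 1000000) (ρ₀ := 57 / 100) (by norm_num) (by norm_num) (by norm_num)
    (exp_le_taylor4 (x := 57 / 500) (by norm_num) (by norm_num)) sqrt_two_le (by norm_num) (by norm_num)
    (by norm_num) (by unfold doorPoly; norm_num) (by unfold gaugeR Delta; norm_num) (by norm_num) R
  rw [e1] at h
  have hlog : -Real.log (max (57 / 100 : ℝ) (1 / 2)) = Real.log (100 / 57) := by
    rw [show max (57 / 100 : ℝ) (1 / 2) = 57 / 100 by norm_num, ← Real.log_inv]; norm_num
  rw [hlog] at h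
  exact h

/-- **`ℤ³`, UP TO `β_W = 1/2`, ONE EXPLICIT `(m, A) = ((1/200)/(max R 1 + 4), 4√2)`** on the frontier ball
`MemBallZdG (17/500) (17/1000) R` (received sum `≤ 199/200` along the whole segment; the certificate of
`su2_massGapOnBallZdG_dim3_star_upTo_oneHalf`). -/
theorem su2_dim3_localScreeningStar_upTo_oneHalf {βW : ℝ} (h0 : 0 ≤ βW) (h : βW ≤ 1 / 2) (R : ℕ) :
    LocalScreeningOnBallZdG 3 2 (βW / 4) (17 / 500) (17 / 1000) R ((1 / 200 : ℝ) / (max R 1 + 4 : ℕ)) (4 * Real.sqrt 2) := by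
  have e2 : (1 : ℝ) - 199 / 200 = 1 / 200 := by norm_num
  rw [← e2]
  refine su2_dim3_localScreeningOnBallZdG_star_linear 20 (ε₀ := 17 / 500) (ε₁ := 17 / 1000) (c := 67771 / 500000)
    (lam := 12021 / 500000) (E := 206917 / 200000) (S := 1.41422) (ρ₀ := 199 / 200) h0 (h.trans (by norm_num)) (by norm_num)
    exp_le_17_500_star sqrt_two_le ?_ (by norm_num) (by norm_num) (by unfold doorPoly; norm_num)
    (by unfold gaugeR Delta; norm_num) (by norm_num) (by norm_num) R
  calc (206917 / 200000 : ℝ) * (1 + 2 * 1.41422 * (17 / 1000)) * (βW / 4)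
      ≤ 206917 / 200000 * (1 + 2 * 1.41422 * (17 / 1000)) * ((1 / 2) / 4) := by gcongr
    _ ≤ 67771 / 500000 := by norm_num

/-- **THE `ℤ³` WILSON POINT, `SU(2)`, EVERY `0 ≤ β_W ≤ 1/2`, EXPLICIT**: every bounded local modification of the `SU(2)` Wilson
action on `ℤ³` (terms reading only the links of a finite `S`, any strength) is screened in every DLR state at rate `(1/200)/5`,
constant `4√2 · #Λ · K_F`. -/
theorem su2_dim3_wilson_localScreeningStar_upTo_oneHalf {βW : ℝ} (h0 : 0 ≤ βW) (h1 : βW ≤ 1 / 2)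
    {V : Potential (ZdEdge 3) (SUN 2)} (hV : V.IsAdapted) (hVb : ∀ X, ∃ C, ∀ U, |V X U| ≤ C)
    {suppV : Finset (ZdEdge 3) → Finset (Finset (ZdEdge 3))} (hsuppV : V.IsSupportedBy suppV)
    {S : Finset (ZdEdge 3)} (hVS : ∀ X, DependsOn (V X) (↑S : Set (ZdEdge 3)))
    {μ ν : Measure (LGConfig 3 (SUN 2))}
    (hμ : μ ∈ ymGibbsMeasures (d := 3) (fundamentalRep (Fin 2)) (2 * (βW / 4)))
    (hν : ν ∈ perturbedGibbsMeasures (d := 3) (fundamentalRep (Fin 2)) (2 * (βW / 4)) V suppV)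
    {F : LGConfig 3 (SUN 2) → ℝ} {Λ : Finset (ZdEdge 3)} {KF : ℝ≥0}
    (hF : IsLipschitzCylinder (fundamentalRep (Fin 2)) F Λ KF) :
    |(∫ σ, F σ ∂μ) - ∫ σ, F σ ∂ν| ≤ 4 * Real.sqrt 2 * exp (-((1 / 200 : ℝ) / 5) * setDistEdges Λ S) * (Λ.card * KF) := by
  have hball := su2_dim3_localScreeningStar_upTo_oneHalf h0 h1 0
  have e5 : ((max 0 1 + 4 : ℕ) : ℝ) = 5 := by norm_num
  rw [e5] at hball
  have hmem : MemBallZdG (N := 2) (d := 3) (17 / 500) (17 / 1000) 0 0 (fun _ => (∅ : Finset (Finset (ZdEdge 3)))) :=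
    memBallZdG_zero (by norm_num) (by norm_num) 0
  have hμ' : μ ∈ perturbedGibbsMeasures (d := 3) (fundamentalRep (Fin 2)) ((2 : ℕ) * (βW / 4))
      (0 : Potential (ZdEdge 3) (SUN 2)) (fun _ => ∅) := by
    rw [perturbedGibbsMeasures_zero]; exact_mod_cast hμ
  have hν' : ν ∈ perturbedGibbsMeasures (d := 3) (fundamentalRep (Fin 2)) ((2 : ℕ) * (βW / 4))
      ((0 : Potential (ZdEdge 3) (SUN 2)) + V)
      (fun Λ => (fun _ : Finset (ZdEdge 3) => (∅ : Finset (Finset (ZdEdge 3)))) Λ ∪ suppV Λ) := by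
    simpa only [zero_add, Finset.empty_union, Nat.cast_ofNat] using hν
  exact hball 0 _ hmem V hV hVb suppV hsuppV S hVS μ hμ' ν hν' F Λ KF hF

/-! ### Every `N ≥ 2`, `d = 4`: the eigen modulus; `SU(3)` hypothesis-free cells -/

/-- **SCHEMA, every `N ≥ 2`, `d = 4`, eigen modulus** (the hypotheses of `suN_uniformMassGapOnBallZdG_star_eigen`) with a round bound
`gaugeR 4 c + (λ + (6c+λ)^Kn·16λ)/(1 − (6c+λ)) ≤ ρ₀ < 1`:
`LocalScreeningOnBallZdG 4 N (β_W/N²) ε₀ ε₁ R (log(1/max(ρ₀,½))/(max R 1 + 4)) (4√N)`. -/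
theorem suN_localScreeningOnBallZdG_star_eigen (Kn : ℕ) {N : ℕ} (hN : 2 ≤ N) {βW ε₀ ε₁ c lam E S Kb ρ₀ : ℝ}
    (hβ0 : 0 ≤ βW) (hR : βW / (N : ℝ) ^ 2 * 6 < 1 / 2) (hε₁ : 0 ≤ ε₁) (hE : Real.exp ε₀ ≤ E)
    (hS : Real.sqrt N ≤ S) (hKb : (N : ℝ) ^ 2 / ((N : ℝ) ^ 2 - 1) * ((1 / 2 + 2 * (βW / (N : ℝ) ^ 2 * 6)) /
      (1 / 2 - βW / (N : ℝ) ^ 2 * 6)) ≤ Kb)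
    (hc : Kb * E * (1 + 2 * S * ε₁) * (βW / (N : ℝ) ^ 2) ≤ c) (hlam : S * ε₁ ≤ lam) (hθ1 : 6 * c + lam < 1)
    (hcd : doorPoly 4 c < 1)
    (hρ0 : gaugeR 4 c + (lam + (6 * c + lam) ^ Kn * (16 * lam)) / (1 - (6 * c + lam)) ≤ ρ₀) (hρ1 : ρ₀ < 1)
    (R : ℕ) :
    LocalScreeningOnBallZdG 4 N (βW / (N : ℝ) ^ 2) ε₀ ε₁ R (-Real.log (max ρ₀ (1 / 2)) / (max R 1 + 4 : ℕ)) (4 * Real.sqrt N) := by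
  have hN1 : 1 ≤ N := by omega
  have hNpos : (0 : ℝ) < N := by exact_mod_cast (show 0 < N by omega)
  have hN2 : (2 : ℝ) ≤ N := by exact_mod_cast hN
  set Rm : ℝ := βW / (N : ℝ) ^ 2 * 6 with hRdef
  set K : ℝ := (N : ℝ) ^ 2 / ((N : ℝ) ^ 2 - 1) * ((1 / 2 + 2 * Rm) / (1 / 2 - Rm)) with hKdef
  have hmod : OneLinkKRModulus N Rm K := OneLinkEigen.oneLinkKRModulus_eigen hN hR
  have hK0 : 0 ≤ K := by
    have h1 : (0 : ℝ) < (N : ℝ) ^ 2 - 1 := by nlinarith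
    have h2 : (0 : ℝ) < 1 / 2 - Rm := by linarith
    positivity
  have hS0 : 0 ≤ S := (Real.sqrt_nonneg _).trans hS
  have hE0 : 0 ≤ E := (Real.exp_pos _).le.trans hE
  have hKb0 : 0 ≤ Kb := hK0.trans hKb
  set θ : ℝ := 6 * c + lam with hθ
  set ρ : ℝ := gaugeR 4 c + (lam + θ ^ Kn * (16 * lam)) / (1 - θ) with hρ
  have habs : |(N : ℝ) * (βW / (N : ℝ) ^ 2)| / (N : ℝ) = βW / (N : ℝ) ^ 2 := by
    rw [abs_of_nonneg (by positivity)]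
    field_simp
  have hR' : |(N : ℝ) * (βW / (N : ℝ) ^ 2)| / (N : ℝ) * (2 * (((4 : ℕ) : ℝ) - 1)) ≤ Rm := by
    rw [habs, hRdef]; norm_num
  have hc' : K * Real.exp ε₀ * (1 + 2 * Real.sqrt N * ε₁) * (|(N : ℝ) * (βW / (N : ℝ) ^ 2)| / (N : ℝ)) ≤ c := by
    refine le_trans ?_ hc
    rw [habs]
    have hb : 0 ≤ βW / (N : ℝ) ^ 2 := by positivity
    have h2 : 1 + 2 * Real.sqrt N * ε₁ ≤ 1 + 2 * S * ε₁ := by nlinarith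
    have h3 : 0 ≤ 1 + 2 * Real.sqrt N * ε₁ := by positivity
    calc K * Real.exp ε₀ * (1 + 2 * Real.sqrt N * ε₁) * (βW / (N : ℝ) ^ 2)
        ≤ Kb * E * (1 + 2 * Real.sqrt N * ε₁) * (βW / (N : ℝ) ^ 2) := by gcongr
      _ ≤ Kb * E * (1 + 2 * S * ε₁) * (βW / (N : ℝ) ^ 2) := by gcongr
  have hlam' : Real.sqrt N * ε₁ ≤ lam := le_trans (mul_le_mul_of_nonneg_right hS hε₁) hlam
  have hθ' : θ = (2 * ((4 : ℕ) : ℝ) - 2) * c + lam := by rw [hθ]; push_cast; ring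
  have hρ' : ρ = gaugeR 4 c + (lam + θ ^ Kn * (4 * ((4 : ℕ) : ℝ) * lam)) / (1 - θ) := by rw [hρ]; push_cast; ring
  exact localScreeningOnBallZdG_of_robustStar (d := 4) (N := N) (by norm_num) hN1 hK0 hR' hmod hε₁ hc' hlam' hθ' hθ1
    hcd hρ' hρ0 hρ1

/-- **CELL `SU(3)`, `β_W = 1/8` ('t Hooft `1/72`), QUARTER RADIUS `(37/500, 37/1000)`, HYPOTHESIS-FREE**: received sum `≤ 31/100` ⇒
screening at rate `log 2/(max R 1 + 4)` with constant `4√3 · #Λ · K_F` (eigen modulus `K = 9/5`; certificate `c = 30371/1000000`,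
`λ = 64087/1000000`, `E = T₄(37/500)`, `√3 ≤ 1.73206`). -/
theorem su3_localScreeningStar_oneEighth_quarterRadius (R : ℕ) :
    LocalScreeningOnBallZdG 4 3 (1 / 72) (37 / 500) (37 / 1000) R (Real.log 2 / (max R 1 + 4 : ℕ)) (4 * Real.sqrt 3) := by
  have e1 : (1 / 8 : ℝ) / ((3 : ℕ) : ℝ) ^ 2 = 1 / 72 := by norm_num
  have hS : Real.sqrt ((3 : ℕ) : ℝ) ≤ 1.73206 := by
    have : ((3 : ℕ) : ℝ) = 3 := by norm_num
    rw [this]; exact sqrt_three_le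
  have h := suN_localScreeningOnBallZdG_star_eigen 20 (N := 3) (by norm_num) (βW := 1 / 8) (ε₀ := 37 / 500)
    (ε₁ := 37 / 1000) (c := 30371 / 1000000) (lam := 64087 / 1000000) (S := 1.73206) (Kb := 9 / 5) (ρ₀ := 31 / 100)
    (by norm_num) (by norm_num) (by norm_num) (exp_le_taylor4 (x := 37 / 500) (by norm_num) (by norm_num)) hS (by norm_num)
    (by norm_num) (by norm_num) (by norm_num) (by unfold doorPoly; norm_num) (by unfold gaugeR Delta; norm_num) (by norm_num) R
  rw [e1] at h
  have hlog : -Real.log (max (31 / 100 : ℝ) (1 / 2)) = Real.log 2 := by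
    rw [show max (31 / 100 : ℝ) (1 / 2) = 1 / 2 by norm_num, one_div, Real.log_inv, neg_neg]
  have h3 : (4 * Real.sqrt ((3 : ℕ) : ℝ) : ℝ) = 4 * Real.sqrt 3 := by norm_num
  rw [h3, hlog] at h
  exact h

/-- **CELL `SU(3)`, `β_W = 1/8`, HALF RADIUS `(37/250, 37/500)`, HYPOTHESIS-FREE**: received sum `≤ 47/100 ≤ 1/2` ⇒ rate
`log 2/(max R 1 + 4)`, constant `4√3 · #Λ · K_F` (certificate `c = 36419/1000000`, `λ = 128173/1000000`). -/
theorem su3_localScreeningStar_oneEighth_halfRadius (R : ℕ) :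
    LocalScreeningOnBallZdG 4 3 (1 / 72) (37 / 250) (37 / 500) R (Real.log 2 / (max R 1 + 4 : ℕ)) (4 * Real.sqrt 3) := by
  have e1 : (1 / 8 : ℝ) / ((3 : ℕ) : ℝ) ^ 2 = 1 / 72 := by norm_num
  have hS : Real.sqrt ((3 : ℕ) : ℝ) ≤ 1.73206 := by
    have : ((3 : ℕ) : ℝ) = 3 := by norm_num
    rw [this]; exact sqrt_three_le
  have h := suN_localScreeningOnBallZdG_star_eigen 20 (N := 3) (by norm_num) (βW := 1 / 8) (ε₀ := 37 / 250)
    (ε₁ := 37 / 500) (c := 36419 / 1000000) (lam := 128173 / 1000000) (S := 1.73206) (Kb := 9 / 5) (ρ₀ := 47 / 100)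
    (by norm_num) (by norm_num) (by norm_num) (exp_le_taylor4 (x := 37 / 250) (by norm_num) (by norm_num)) hS (by norm_num)
    (by norm_num) (by norm_num) (by norm_num) (by unfold doorPoly; norm_num) (by unfold gaugeR Delta; norm_num) (by norm_num) R
  rw [e1] at h
  have hlog : -Real.log (max (47 / 100 : ℝ) (1 / 2)) = Real.log 2 := by
    rw [show max (47 / 100 : ℝ) (1 / 2) = 1 / 2 by norm_num, one_div, Real.log_inv, neg_neg]
  have h3 : (4 * Real.sqrt ((3 : ℕ) : ℝ) : ℝ) = 4 * Real.sqrt 3 := by norm_num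
  rw [h3, hlog] at h
  exact h

/-! ### The variance-form robust star door (PV2): `SU(3)` hypothesis-free up to `β_W = 17/50` -/

/-- **SCHEMA, `SU(3)`, `d = 4`, HYPOTHESIS-FREE, PV2 variance form, free modulus radius** (the hypotheses of engine-2's
`su3_massGapOnBallZdG_pv2Star_rad`: 't Hooft coupling `β_W/9`, `6β_W/9 ≤ R_m < 1/2`, `τ > 1`, envelope constants `K_s, S_q, E, E₂`)
with a round bound `… ≤ ρ₀`, `1/2 ≤ ρ₀ < 1` (linear reading):
`LocalScreeningOnBallZdG 4 3 (β_W/9) ε₀ ε₁ R ((1 − ρ₀)/(max R 1 + 4)) (4√3)`. -/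
theorem su3_localScreeningOnBallZdG_pv2Star_rad (Kn : ℕ) {βW ε₀ ε₁ c lam E E₂ τ Ks Sq Rm ρ₀ : ℝ} (hβ0 : 0 ≤ βW)
    (hRm : βW / 9 * 6 ≤ Rm) (hR : Rm < 1 / 2) (hε₁ : 0 ≤ ε₁) (hE : Real.exp ε₀ ≤ E) (hE₂ : Real.exp (ε₀ / 2) ≤ E₂) (hτ : 1 < τ)
    (hKs0 : 0 ≤ Ks) (hKs : 16 * τ * (τ - 1) + 9 * τ ^ 3 * Rm ^ 2 ≤ 16 * (τ - 1) * (Ks ^ 2 * (1 / 2 - Rm)))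
    (hSq0 : 0 ≤ Sq) (hSq : 1 ≤ 3 * Sq ^ 2 * (1 / 2 - Rm)) (hc : E * Ks * (βW / 9) ≤ c)
    (hlam : E₂ * Sq * ε₁ ≤ lam) (hθ1 : 6 * c + lam < 1) (hcd : doorPoly 4 c < 1)
    (hρ0 : gaugeR 4 c + (lam + (6 * c + lam) ^ Kn * (16 * lam)) / (1 - (6 * c + lam)) ≤ ρ₀) (hhalf : 1 / 2 ≤ ρ₀)
    (hρ1 : ρ₀ < 1) (Rr : ℕ) :
    LocalScreeningOnBallZdG 4 3 (βW / 9) ε₀ ε₁ Rr ((1 - ρ₀) / (max Rr 1 + 4 : ℕ)) (4 * Real.sqrt 3) := by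
  obtain ⟨hP, hV, h1, h2⟩ := su3_pv2_star_inputs (x := βW / 9) hR hτ hε₁ (by positivity) hE hE₂ hKs0 hKs hSq0 hSq
  have htN : |((3 : ℕ) : ℝ) * (βW / 9)| / ((3 : ℕ) : ℝ) = βW / 9 := by
    rw [abs_of_nonneg (by positivity)]; field_simp
  have hb' : |((3 : ℕ) : ℝ) * (βW / 9)| / ((3 : ℕ) : ℝ) * (2 * (((4 : ℕ) : ℝ) - 1)) ≤ Rm := by
    rw [htN]; norm_num; linarith
  have hc' : Real.exp ε₀ * Real.sqrt (1 / (3 * (1 / 2 - Rm)) * (3 * (1 / 2 - Rm) * Ks ^ 2)) *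
      (|((3 : ℕ) : ℝ) * (βW / 9)| / ((3 : ℕ) : ℝ)) ≤ c := by
    rw [htN]; exact h1.trans hc
  have hθ' : (6 : ℝ) * c + lam = (2 * ((4 : ℕ) : ℝ) - 2) * c + lam := by push_cast; ring
  have hρ' : gaugeR 4 c + (lam + (6 * c + lam) ^ Kn * (16 * lam)) / (1 - (6 * c + lam)) =
      gaugeR 4 c + (lam + (6 * c + lam) ^ Kn * (4 * ((4 : ℕ) : ℝ) * lam)) / (1 - (6 * c + lam)) := by push_cast; ring
  have h3 : (4 * Real.sqrt ((3 : ℕ) : ℝ) : ℝ) = 4 * Real.sqrt 3 := by norm_num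
  rw [← h3]
  have key := localScreeningOnBallZdG_of_robustStar_variance (d := 4) (N := 3) (by norm_num) (by norm_num) (Kn := Kn)
    (by positivity) (by positivity) hb' hP hV hε₁ hc' (h2.trans hlam) hθ' hθ1 hcd hρ' hρ0 hρ1 (R := Rr)
  have hD : (0 : ℝ) < ((max Rr 1 + 4 : ℕ) : ℝ) := by positivity
  have hmax : max ρ₀ (1 / 2) = ρ₀ := max_eq_left hhalf
  have hrate : 1 - ρ₀ ≤ -Real.log (max ρ₀ (1 / 2)) := by
    rw [hmax]; have := Real.log_le_sub_one_of_pos (show (0 : ℝ) < ρ₀ by linarith); linarith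
  exact key.mono le_rfl le_rfl le_rfl (div_le_div_of_nonneg_right hrate hD.le) le_rfl (by positivity)

/-- **`SU(3)`, `ℤ⁴`, HYPOTHESIS-FREE — ONE EXPLICIT `(m, A) = ((1/250)/(max R 1 + 4), 4√3)` FOR THE WHOLE SEGMENT
`0 ≤ β_W ≤ 17/50`** on `MemBallZdG (11/500) (11/1000) R` (engine-2's certificate of the cell `(17/50, .011)` at the fixed modulus radius
`17/75`; received sum `≤ 249/250`): for every member, every local source of any strength and every DLR pair. -/
theorem su3_localScreeningStar_pv2_upTo_seventeenFiftieths {βW : ℝ} (h0 : 0 ≤ βW) (h : βW ≤ 17 / 50) (R : ℕ) :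
    LocalScreeningOnBallZdG 4 3 (βW / 9) (11 / 500) (11 / 1000) R ((1 / 250 : ℝ) / (max R 1 + 4 : ℕ)) (4 * Real.sqrt 3) := by
  have e2 : (1 : ℝ) - 249 / 250 = 1 / 250 := by norm_num
  rw [← e2]
  have hc : (255561 / 250000 : ℝ) * (229679 / 100000) * (βW / 9) ≤ 44349 / 500000 := by
    have h1 : (255561 / 250000 : ℝ) * (229679 / 100000) * (βW / 9) ≤
        (255561 / 250000 : ℝ) * (229679 / 100000) * ((17 / 50 : ℝ) / 9) :=
      mul_le_mul_of_nonneg_left (by linarith) (by norm_num)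
    exact h1.trans (by norm_num)
  exact su3_localScreeningOnBallZdG_pv2Star_rad 20 (βW := βW) (ε₀ := 11 / 500) (ε₁ := 11 / 1000) (c := 44349 / 500000)
    (lam := 6141 / 500000) (E := 255561 / 250000) (E₂ := 1011061 / 1000000) (τ := 581 / 500) (Ks := 229679 / 100000)
    (Sq := 276079 / 250000) (Rm := 17 / 75) (ρ₀ := 249 / 250) h0 (by linarith) (by norm_num) (by norm_num)
    (by refine (Real.exp_bound' (x := 11 / 500) (by norm_num) (by norm_num) (n := 5) (by norm_num)).trans ?_
        simp only [Finset.sum_range_succ, Finset.sum_range_zero, Nat.factorial]; norm_num)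
    (by refine (Real.exp_bound' (x := 11 / 500 / 2) (by norm_num) (by norm_num) (n := 5) (by norm_num)).trans ?_
        simp only [Finset.sum_range_succ, Finset.sum_range_zero, Nat.factorial]; norm_num)
    (by norm_num) (by norm_num) (by norm_num) (by norm_num) (by norm_num) hc (by norm_num) (by norm_num) (by unfold doorPoly; norm_num)
    (by unfold gaugeR Delta; norm_num) (by norm_num) (by norm_num) R

/-- **THE `SU(3)` WILSON POINT ON `ℤ⁴`, EVERY `0 ≤ β_W ≤ 17/50`, HYPOTHESIS-FREE, EXPLICIT**: every bounded local modification of the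
`SU(3)` Wilson action (tree coupling `β_W/3`; terms reading only the links of a finite `S`, any strength) is screened in every DLR state
at rate `(1/250)/5`, constant `4√3 · #Λ · K_F`. -/
theorem su3_wilson_localScreeningStar_upTo_seventeenFiftieths {βW : ℝ} (h0 : 0 ≤ βW) (h1 : βW ≤ 17 / 50)
    {V : Potential (ZdEdge 4) (SUN 3)} (hV : V.IsAdapted) (hVb : ∀ X, ∃ C, ∀ U, |V X U| ≤ C)
    {suppV : Finset (ZdEdge 4) → Finset (Finset (ZdEdge 4))} (hsuppV : V.IsSupportedBy suppV)
    {S : Finset (ZdEdge 4)} (hVS : ∀ X, DependsOn (V X) (↑S : Set (ZdEdge 4)))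
    {μ ν : Measure (LGConfig 4 (SUN 3))}
    (hμ : μ ∈ ymGibbsMeasures (d := 4) (fundamentalRep (Fin 3)) (3 * (βW / 9)))
    (hν : ν ∈ perturbedGibbsMeasures (d := 4) (fundamentalRep (Fin 3)) (3 * (βW / 9)) V suppV)
    {F : LGConfig 4 (SUN 3) → ℝ} {Λ : Finset (ZdEdge 4)} {KF : ℝ≥0}
    (hF : IsLipschitzCylinder (fundamentalRep (Fin 3)) F Λ KF) :
    |(∫ σ, F σ ∂μ) - ∫ σ, F σ ∂ν| ≤ 4 * Real.sqrt 3 * exp (-((1 / 250 : ℝ) / 5) * setDistEdges Λ S) * (Λ.card * KF) := by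
  have hball := su3_localScreeningStar_pv2_upTo_seventeenFiftieths h0 h1 0
  have e5 : ((max 0 1 + 4 : ℕ) : ℝ) = 5 := by norm_num
  rw [e5] at hball
  have hmem : MemBallZdG (N := 3) (d := 4) (11 / 500) (11 / 1000) 0 0 (fun _ => (∅ : Finset (Finset (ZdEdge 4)))) :=
    memBallZdG_zero (by norm_num) (by norm_num) 0
  have hμ' : μ ∈ perturbedGibbsMeasures (d := 4) (fundamentalRep (Fin 3)) ((3 : ℕ) * (βW / 9))
      (0 : Potential (ZdEdge 4) (SUN 3)) (fun _ => ∅) := by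
    rw [perturbedGibbsMeasures_zero]; exact_mod_cast hμ
  have hν' : ν ∈ perturbedGibbsMeasures (d := 4) (fundamentalRep (Fin 3)) ((3 : ℕ) * (βW / 9))
      ((0 : Potential (ZdEdge 4) (SUN 3)) + V)
      (fun Λ => (fun _ : Finset (ZdEdge 4) => (∅ : Finset (Finset (ZdEdge 4)))) Λ ∪ suppV Λ) := by
    simpa only [zero_add, Finset.empty_union, Nat.cast_ofNat] using hν
  exact hball 0 _ hmem V hV hVb suppV hsuppV S hVS μ hμ' ν hν' F Λ KF hF

end Summit.Ventures.YMGap.RobustBall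

end
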